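/-
Copyright: the b2b-balaban T⁴-continuum CRUX team, row NE7b OWNER lineage `t4-ne7b-p1` (gen 127). Project licence.
-/
import Summits.QuantumFields.BalabanUV.T4Continuum.Spine.NE7b.SupTorusFibreFiniteRangeDecomposition
import Summits.QuantumFields.BalabanUV.T4Continuum.Spine.NE7b.SupFibreScaleSmallField

/-!
# THE SIZES OF THE SCALES ON THE TORUS: at EVERY field `φ` of the road's class on the fine torus `(ℤ∕(n+1)s)^d`, with (279)'s block chart
# and the road's linearised form `H_φ` ((281)'s objects), the scale-`N` piece of the fluctuation covariance has ENTRIES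
# `|Γ_N(x,y)| ≤ c·q·π⁴∕(4·4^N·(c·m)²)` and the scale-`N` chart field exceeds a threshold `κ` somewhere with probability
# `≤ #σ·2exp(−κ²∕(2c·π⁴∕(4·4^N(cm)²)))` — `m = min(2,a) − λ`, `q = (n+1)^d + 1`, `c = 4∕((4d(n+1)² + a + Λ)q)`: (284)∕(285) READ ON THE ROAD'S
# CARRIERS, every `d, n, s ≥ 1`, `a > 0`, `−λ ≤ u″∘φ ≤ Λ`, `λ < min(2,a)` (row NE7b, node U5c; (281)∕(284)∕(285) BY NAME; [folklore])

Cell `pub-balaban`, sub-cell `t4`, spine estimate NE7b (`T4WeightBudget.RelWeightBound`; the cell's OWN estimate — NOT PRINTED in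
[Bałaban 1983–89], NOT PROVED).  Crux-route work under `Spine/NE7b/` by the row OWNER (`t4-ne7b-p1` gen 127, file (286)) under FREEZE
(0)'s crux-prover clause, on § [NE7bP1-G126-HANDOFF] NEXT (3)(d); NOTHING of Bałaban's is named as a Lean object, valued or asserted; no
`T4Continuum/Support` leaf typed; no `def`, no notation; zero `sorry`.  Imports (BY NAME): the OWNER's (281)
`…SupTorusFibreFiniteRangeDecomposition` (`torus_fibre_covariance_frd`, `torus_form_blockCeiling`), (285) `…SupFibreScaleSmallField`
(`scale_largeField_le`; through it (284) `fibre_piece_entries_decay`).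

WHY (located).  (284)∕(285) are TEA-level statements over (273)'s abstract data; this file is their dictionary entry on the torus, so the
successor's scale-by-scale bookkeeping quotes mesh-explicit constants: the floor is the road's `min(2,a) − λ`, the ceilings are
`4d(n+1)² + a + Λ` ((106)) and `(n+1)^d + 1` ((109)), the chart bound is `1`.

WHAT IS PROVED ([folklore]): THE END **`torus_scale_sizes`** — `∃ P H_φ` ((279)'s chart clauses; the displayed pairing, symmetric, floor)
such that for ANY `M_z` with `M_z(j,k) = H_φ(Pe_j)(Pe_k)`, every scale `N`: (i) the field piece `Γ_N = Γ(c·C_N(cM_z))` has entries bounded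
by `c·q·π⁴∕(4·4^N·(c·m·1)²)`; (ii) for every `κ ≥ 0`, the scale-`N` chart law gives `{∃ j, κ ≤ |ζ_j|}` probability
`≤ #σ·2exp(−κ²∕(2·c·π⁴∕(4·4^N·(c·m·1)²)))`; §2 toy.

HONEST (what this is NOT).  One `obtain` on (281) + (284)∕(285); constants are mesh-DEPENDENT through the chart conditioning `q` and the
operator ceiling (lattice units); no summation over scales, no polymer activities; cubic periods; scalar skeleton ((A3), NC-NE7b-α
UNRULED); nothing of Bałaban's asserted.  BY-NAME EFFECT ON THE WALL: NONE.  NE7b NOT PRINTED ∕ NOT PROVED; spine PROVED 0∕9; rung (B)+1 on a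
FINITE torus — NOT infinite volume, NOT the mass gap, NOT Clay.  HONEST DEPENDENCY: continuum YM on T⁴ ⇐ BetaPertH ∧ nine spine estimates
(0∕9 proved); BetaPertH ⇐ (D1) ∧ (D4) ∧ CAP+tail; G-an2-4 gates asym, D1 and NE2∕3∕4.
-/

set_option autoImplicit false

noncomputable section

namespace Summit.QuantumFields.BalabanUV.T4Continuum.NE7b.SupTorusScaleSizes

open MeasureTheory ProbabilityTheory Matrix Real
open scoped ENNReal
open Literature.MathematicalPhysics.QuantumFieldTheory.Balaban1983to89
open Literature.Analysis.Matrix (frdPiece)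
open B6QGQLower276 (X e blk B side AX)
open B5Hk103ScalarZd (nbhd)
open Beta (Site siteOf windowMap)
open SupTorusFibreFiniteRangeDecomposition (torus_fibre_covariance_frd torus_form_blockCeiling)
open SupFrdPieceDecay (fibre_piece_entries_decay)
open SupFibreScaleSmallField (scale_largeField_le)

variable {d : ℕ} (n : ℕ) (a : ℝ) (s : ℕ) [NeZero s]
  {Dop Aop : lp (fun _ : X d => ℝ) ∞ →L[ℝ] lp (fun _ : X d => ℝ) ∞}
  (hA : ∀ (f : lp (fun _ : X d => ℝ) ∞) (p : X d), Aop f p = ∑ r ∈ nbhd n p, AX n a p r * f r)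
  (hD : ∀ (f : lp (fun _ : X d => ℝ) ∞) (y : X d), Dop f y = (((n : ℝ) + 1) ^ d)⁻¹ * ∑ p ∈ B n y, f p)
  {Ef : (Site d ((n + 1) * s) → ℝ) →L[ℝ] lp (fun _ : X d => ℝ) ∞}
  (hEf : ∀ (g : Site d ((n + 1) * s) → ℝ) (q : X d), Ef g q = g (siteOf d ((n + 1) * s) q))
  {Rf : lp (fun _ : X d => ℝ) ∞ →L[ℝ] (Site d ((n + 1) * s) → ℝ)}
  (hRf : ∀ (h : lp (fun _ : X d => ℝ) ∞) (x : Site d ((n + 1) * s)), Rf h x = h (windowMap d ((n + 1) * s) x))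
  {Rc : lp (fun _ : X d => ℝ) ∞ →L[ℝ] (Site d s → ℝ)}
  (hRc : ∀ (h : lp (fun _ : X d => ℝ) ∞) (x : Site d s), Rc h x = h (windowMap d s x))

/-! ## §1. THE END -/

include hA hD hEf hRf hRc in
/-- **HEADLINE — THE SIZES OF THE SCALES ON THE TORUS.**  `0 < a`, `0 ≤ Λ`, `−λ ≤ u″(φ x) ≤ Λ`, `λ < min(2,a)` ⟹ `∃ P H_φ` ((279)'s chart:
zero block means, bound `1`, ceiling `(n+1)^d + 1`, onto the fibre, block-local; the road's form: displayed pairing, symmetric, floor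
`min(2,a) − λ`) such that for ANY `M_z` with `M_z(j,k) = H_φ(Pe_j)(Pe_k)` and every scale `N`, with `q = (n+1)^d + 1`, `c = 4∕((4d(n+1)² + a + Λ)q)`,
`m = min(2,a) − λ`, `K_N = c·π⁴∕(4·4^N·(c·m·1)²)`: (i) `|Γ_N(x,y)| ≤ q·K_N` for all fine sites; (ii) for every `κ ≥ 0`, under
`N(0, c·C_N(cM_z))`, `P(∃ j, κ ≤ |ζ_j|) ≤ #σ·2e^{−κ²∕(2K_N)}`. [folklore] -/
theorem torus_scale_sizes (ha : 0 < a) {u' : ℝ → ℝ} {lam Lam : ℝ} {φ : Site d ((n + 1) * s) → ℝ} (hLam : 0 ≤ Lam)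
    (hu' : ∀ x, -lam ≤ u' (φ x)) (hu'Λ : ∀ x, u' (φ x) ≤ Lam) (hγ : lam < min 2 a) :
    ∃ (P : ((Site d s × {z : Fin d → Fin (n + 1) // z ≠ 0}) → ℝ) →L[ℝ] (Site d ((n + 1) * s) → ℝ))
      (Hφ : (Site d ((n + 1) * s) → ℝ) →L[ℝ] (Site d ((n + 1) * s) → ℝ) →L[ℝ] ℝ),
      (∀ ζ, ((Rc.comp Dop).comp Ef) (P ζ) = 0) ∧
      (∀ ζ, (1 : ℝ) * ∑ i, ζ i ^ 2 ≤ ∑ x, P ζ x ^ 2) ∧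
      (∀ ζ, ∑ x, P ζ x ^ 2 ≤ (((n : ℝ) + 1) ^ d + 1) * ∑ i, ζ i ^ 2) ∧
      (∀ h : Site d ((n + 1) * s) → ℝ, ((Rc.comp Dop).comp Ef) h = 0 → ∃ ζ, P ζ = h) ∧
      (∀ (j : Site d s × {z : Fin d → Fin (n + 1) // z ≠ 0}) (x : Site d ((n + 1) * s)),
        siteOf d s (blk n (windowMap d ((n + 1) * s) x)) ≠ j.1 → P (Pi.single j 1) x = 0) ∧
      (∀ h k, Hφ h k = ∑ x, (((Rf.comp Aop).comp Ef) h x + u' (φ x) * h x) * k x) ∧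
      (∀ h k, Hφ h k = Hφ k h) ∧
      (∀ h, (min 2 a - lam) * ∑ x, h x ^ 2 ≤ Hφ h h) ∧
      ∀ Mz : Matrix (Site d s × {z : Fin d → Fin (n + 1) // z ≠ 0}) (Site d s × {z : Fin d → Fin (n + 1) // z ≠ 0}) ℝ,
        (∀ j k, Mz j k = Hφ (P (Pi.single j 1)) (P (Pi.single k 1))) → ∀ N : ℕ,
        (∀ x y, |∑ j, ∑ k, P (Pi.single j 1) x * (((4 / ((4 * d * ((n : ℝ) + 1) ^ 2 + a + Lam) * (((n : ℝ) + 1) ^ d + 1))) : ℝ) • frdPiece (((4 / ((4 * d * ((n : ℝ) + 1) ^ 2 + a + Lam) * (((n : ℝ) + 1) ^ d + 1))) : ℝ) • Mz) N) j k * P (Pi.single k 1) y|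
          ≤ ((4 / ((4 * d * ((n : ℝ) + 1) ^ 2 + a + Lam) * (((n : ℝ) + 1) ^ d + 1))) : ℝ) * (((n : ℝ) + 1) ^ d + 1) * (π ^ 4 / (4 * 4 ^ N * (((4 / ((4 * d * ((n : ℝ) + 1) ^ 2 + a + Lam) * (((n : ℝ) + 1) ^ d + 1))) : ℝ) * (min 2 a - lam) * 1) ^ 2))) ∧
        (∀ κ : ℝ, 0 ≤ κ →
          (multivariateGaussian 0 (((4 / ((4 * d * ((n : ℝ) + 1) ^ 2 + a + Lam) * (((n : ℝ) + 1) ^ d + 1))) : ℝ) • frdPiece (((4 / ((4 * d * ((n : ℝ) + 1) ^ 2 + a + Lam) * (((n : ℝ) + 1) ^ d + 1))) : ℝ) • Mz) N)).real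
              {ω : EuclideanSpace ℝ (Site d s × {z : Fin d → Fin (n + 1) // z ≠ 0}) | ∃ j, κ ≤ |ω j|}
            ≤ Fintype.card (Site d s × {z : Fin d → Fin (n + 1) // z ≠ 0})
              * (2 * exp (-κ ^ 2 / (2 * (((4 / ((4 * d * ((n : ℝ) + 1) ^ 2 + a + Lam) * (((n : ℝ) + 1) ^ d + 1))) : ℝ) * (π ^ 4 / (4 * 4 ^ N * (((4 / ((4 * d * ((n : ℝ) + 1) ^ 2 + a + Lam) * (((n : ℝ) + 1) ^ d + 1))) : ℝ) * (min 2 a - lam) * 1) ^ 2))))))) := by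
  classical
  obtain ⟨P, Hφ, hQP, hPlow, hPup, hPsurj, hPloc, hH, hHsym, hfl, -⟩ :=
    torus_fibre_covariance_frd n a s hA hD hEf hRf hRc ha hLam hu' hu'Λ hγ
  have hm : 0 < min 2 a - lam := sub_pos.2 hγ
  have hΛH : 0 < 4 * d * ((n : ℝ) + 1) ^ 2 + a + Lam := by positivity
  have hq : (0 : ℝ) < ((n : ℝ) + 1) ^ d + 1 := by positivity
  have hceil : ∀ h, Hφ h h ≤ (4 * d * ((n : ℝ) + 1) ^ 2 + a + Lam) * ∑ x, h x ^ 2 := fun h => by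
    rw [hH]; exact torus_form_blockCeiling n a s hA hEf hRf ha.le hu'Λ h
  refine ⟨P, Hφ, hQP, hPlow, hPup, hPsurj, hPloc, hH, hHsym, hfl, fun Mz hMz N => ⟨fun x y => ?_, fun κ hκ => ?_⟩⟩
  · exact fibre_piece_entries_decay P hHsym hfl hm hceil hΛH hPlow one_pos hPup hq Mz hMz N x y
  · exact scale_largeField_le P hHsym hfl hm hceil hΛH hPlow one_pos hPup hq Mz hMz N hκ

/-! ## §2. Toy -/

/-- Toy: the scale constant `K_N = c·π⁴∕(4·4^N·(cm)²)` is positive for positive `c, m` (so the Gaussian tail of §1 is a genuine decay in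
`κ²4^N`). -/
example (c m : ℝ) (hc : 0 < c) (hm : 0 < m) (N : ℕ) : 0 < c * (π ^ 4 / (4 * 4 ^ N * (c * m * 1) ^ 2)) := by positivity

end Summit.QuantumFields.BalabanUV.T4Continuum.NE7b.SupTorusScaleSizes
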